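import Summits.QuantumFields.YangMills.Theorems.AllWindowsColdBoxBoxHighLineTiltCovZeroMain
import Summits.QuantumFields.YangMills.Theorems.AllWindowsColdBoxBoxHighLineRestrictionSetMoments
import Summits.QuantumFields.YangMills.Theorems.AllWindowsColdBoxBoxHighLineCubicCutInsideFP
import Summits.QuantumFields.YangMills.Theorems.AllWindowsColdBoxBoxHighLineGaussianSmallFieldTail

/-!
# U5 Steps D–E glue at `t = 0` ON THE CUT SET — 13r′/13f₀′ (the `t = 0` end of the interpolation over `μ_{D′}` for a GENERAL measurable `D′`) and
# the Gaussian-side co-mass `τ″ = E₀[1 − 1_{D∖E}]` of the cubic cut (✓6g + ✓w5's cubic tail, for EVERY shift constant `C₅ ≥ 0`)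
# (planner ym-idea-2 g18, `Cruxes/BoxWindowHighSU2213/ASSEMBLY-U5.md` v0.2 §3 (D′)/(E′) «f(0) − main: ✓13f₀ … (D′ for D costs τ″)»; LINE-20 U5 ⟨stmt-QuantumFields-24336⟩;
# U5 prep, helper-grade; U5 OPEN)

Width seat `ym-line-sfw-p2-w2` (g33).  Companion of `…GaussianNormalFormOnCutSet` (the `t = 1` side).  With
`μ_{D′} := (volume.restrict D′).withDensity (ofReal ∘ gaussWeight β H)` for an ARBITRARY measurable `D′` (fcl-p3 g27's letters, ✓`…RestrictionSetMoments`),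
`c_x := chartPlaqCost H x 1 2`:

* §1 (ns `…GaussRestrict`) 13r′: `real_compl_set_eq` (`μ_G.real D′ᶜ = E₀[1 − 1_{D′}]·μ_G.real univ`), `restrict_set_eq`, ★`abs_gaussCov_sub_tiltCov_muSet_zero_le`
  (`|gaussCov β H F G − Tilt.tiltCov μ_{D′} U 0 F G| ≤ 6τB²` for measurable `|F|,|G| ≤ B` whenever `E₀[1 − 1_{D′}] ≤ τ ≤ 1/2` — ✓13r `Tilt.abs_tiltCov_zero_sub_restrict_le`);
* §2 (ns `…GaussNormalForm`) 13f₀′: `abs_gaussCov_sub_tiltCov_muSet_zero_le_chartPlaqCost` (`≤ 96τ`) and ★★`abs_sq_mul_tiltCov_muSet_zero_sub_main_le`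
  (`∃ C, ∀ H ≥ 1, ∀ β ≥ 1, ∀ D′ measurable, ∀ τ, E₀[1 − 1_{D′}] ≤ τ ≤ 1/2 → ∀ T, |β²·Tilt.tiltCov μ_{D′} (tiltU β H) 0 c_{boxCentre} c_{boxCentre+Te₀} − (3/4)·boxDirCircSqCov H T| ≤ 96τβ² + C/β`
  — ✓13f₀ verbatim with `D′` for `smallField H s`; `C` = ✓13m's);
* §3 (ns `…GaussRestrict`) the co-mass of the CUT small field `D′ = smallField H s ∖ E`, `E = {1 + C₅βH⁴s⁵ ≤ |cubicVertex β H ·|}` (the event of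
  ✓`SmallFieldFP.exists_beta0_cubicCut`, ANY `C₅ ≥ 0`): `gaussAvg_one_sub_indicator_diff_eq` (`E₀[1 − 1_{D∖E}] = E₀[1 − 1_D] + E₀[1_D·1_E]`),
  ★`gaussAvg_sfInd_mul_indicator_cubicCut_le` (for EVERY `C₅ ≥ 0`, once `C·β·H⁴·s⁵ ≤ 1/2`: `E₀[1_D·1_E] ≤ 4^r·(2r−1)^{3r}·(C·H⁴(1+log H)³/β)^r`, all `r ≥ 1` —
  ✓w5 g23 `EdgeChartGaussian.gaussAvg_sfInd_mul_indicator_cubicVertex_le` at `λ = 1/2` plus the event inclusion `{1 + C₅βH⁴s⁵ ≤ |V₃|} ⊆ {1/2 + CβH⁴s⁵ ≤ |V₃|}`, so NO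
  coordination of `C₅` between the FP side and the Gaussian side is needed), ★★`gaussAvg_one_sub_indicator_cutSet_le` (`τ″ ≤ C₆H⁴e^{−cβs²} + 4^r(2r−1)^{3r}(CH⁴(1+log H)³/β)^r`).

Mathlib + tree only (✓TiltCovZeroMain, ✓RestrictionSetMoments, ✓CubicCutInsideFP, ✓GaussianSmallFieldTail); no definitions; standard axioms.  HONEST LABEL: plumbing for the (UNSTAFFED) third-order assembly `landauThirdOrder_of` of the XL stub U5 of a
critic-PASSed DRAFT line; U5, ⟨24336⟩, ⟨24004⟩ and the seat's own crux ⟨22884⟩ remain OPEN; route AllWindowsColdBox is DRAFT; no crux, rung or summit is proved;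
**the Yang–Mills mass gap is NOT proved by this file; no summit is proved by a line.**
-/

set_option autoImplicit false

noncomputable section

open MeasureTheory Set
open Literature.Probability.LatticeModels (Site)
open Summit.QuantumFields.YangMills.Theorems.WeakCouplingRates (boxCentre plaq12At boxDirCircSqCov)

namespace Summit.QuantumFields.YangMills.Theorems.AllWindowsColdBoxBoxHighLine

/-! ## §1 13r′: the `t = 0` restriction step for a general measurable set -/

namespace GaussRestrict

open EdgeChartGaussian (integrable_gaussWeight integral_gaussWeight_pos gaussWeight_pos)

variable {H : ℕ} {β : ℝ}

/-- `(1 − 1_D)·F = 1_{Dᶜ}·F` pointwise. -/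
theorem one_sub_indicator_mul_eq_compl_indicator (D : Set (LandauFree H → E3)) (F : (LandauFree H → E3) → ℝ) (a : LandauFree H → E3) :
    (1 - D.indicator (fun _ => (1 : ℝ)) a) * F a = Dᶜ.indicator F a := by
  by_cases ha : a ∈ D
  · simp only [indicator_of_mem ha, sub_self, zero_mul, indicator_of_notMem (notMem_compl_iff.2 ha)]
  · simp only [indicator_of_notMem ha, sub_zero, one_mul, indicator_of_mem (mem_compl ha)]

/-- The co-mass of a measurable set: `μ_G.real Dᶜ = E₀[1 − 1_D] · μ_G.real univ`. -/
theorem real_compl_set_eq (hβ : 0 < β) {D : Set (LandauFree H → E3)} (hD : MeasurableSet D) :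
    ((volume : Measure (LandauFree H → E3)).withDensity fun a => ENNReal.ofReal (gaussWeight β H a)).real Dᶜ =
      gaussAvg β H (fun a => 1 - D.indicator (fun _ => (1 : ℝ)) a) *
        ((volume : Measure (LandauFree H → E3)).withDensity fun a => ENNReal.ofReal (gaussWeight β H a)).real univ := by
  rw [real_withDensity_eq H hβ hD.compl, real_withDensity_univ H hβ, gaussAvg]
  have h1 : (fun a : LandauFree H → E3 => (1 - D.indicator (fun _ => (1 : ℝ)) a) * gaussWeight β H a) = Dᶜ.indicator (gaussWeight β H) :=
    funext (one_sub_indicator_mul_eq_compl_indicator D (gaussWeight β H))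
  rw [h1, integral_indicator hD.compl, div_mul_cancel₀ _ (integral_gaussWeight_pos H hβ).ne']

/-- `μ_G.restrict D = μ_D := (volume.restrict D).withDensity (ofReal ∘ gaussWeight)` for a measurable `D`. -/
theorem restrict_set_eq (β : ℝ) {D : Set (LandauFree H → E3)} (hD : MeasurableSet D) :
    ((volume : Measure (LandauFree H → E3)).withDensity fun a => ENNReal.ofReal (gaussWeight β H a)).restrict D =
      ((volume : Measure (LandauFree H → E3)).restrict D).withDensity fun a => ENNReal.ofReal (gaussWeight β H a) :=
  restrict_withDensity hD _

/-- ★ **13r′ — the `t = 0` restriction step for a GENERAL measurable `D`.**  If `E₀[1 − 1_D] ≤ τ ≤ 1/2` then for measurable `F`, `G` with `|F|, |G| ≤ B`: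
`|gaussCov β H F G − Tilt.tiltCov μ_D U 0 F G| ≤ 6τB²` (any tilt letter `U`). -/
theorem abs_gaussCov_sub_tiltCov_muSet_zero_le (hβ : 0 < β) {D : Set (LandauFree H → E3)} (hD : MeasurableSet D) {τ : ℝ}
    (hτ : gaussAvg β H (fun a => 1 - D.indicator (fun _ => (1 : ℝ)) a) ≤ τ) (hτ2 : τ ≤ 1 / 2) (U : (LandauFree H → E3) → ℝ)
    {F G : (LandauFree H → E3) → ℝ} {B : ℝ} (hFm : Measurable F) (hGm : Measurable G) (hFb : ∀ a, |F a| ≤ B) (hGb : ∀ a, |G a| ≤ B) :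
    |gaussCov β H F G -
        Tilt.tiltCov (((volume : Measure (LandauFree H → E3)).restrict D).withDensity fun a => ENNReal.ofReal (gaussWeight β H a)) U 0 F G| ≤
      6 * τ * B ^ 2 := by
  haveI := isFiniteMeasure_withDensity H hβ
  haveI := neZero_withDensity H hβ
  rw [gaussCov_eq_tiltCov_zero H hβ U, ← restrict_set_eq β hD]
  refine Tilt.abs_tiltCov_zero_sub_restrict_le hD ?_ hτ2 U hFm.aestronglyMeasurable hGm.aestronglyMeasurable hFb hGb
  rw [real_compl_set_eq hβ hD]
  exact mul_le_mul_of_nonneg_right hτ measureReal_nonneg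

end GaussRestrict

/-! ## §2 13f₀′: the `t = 0` end of the interpolation over `μ_{D′}` -/

namespace GaussNormalForm

variable {H : ℕ} {β : ℝ}

/-- **13r′ for two chart plaquette costs** (`|c| ≤ 4`): `|gaussCov β H c_x c_y − Tilt.tiltCov μ_D (tiltU β H) 0 c_x c_y| ≤ 96·τ` for a general measurable `D`
with `E₀[1 − 1_D] ≤ τ ≤ 1/2`. -/
theorem abs_gaussCov_sub_tiltCov_muSet_zero_le_chartPlaqCost (hβ : 0 < β) {D : Set (LandauFree H → E3)} (hD : MeasurableSet D) {τ : ℝ}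
    (hτ : gaussAvg β H (fun a => 1 - D.indicator (fun _ => (1 : ℝ)) a) ≤ τ) (hτ2 : τ ≤ 1 / 2) (x y : Site 4) :
    |gaussCov β H (chartPlaqCost H x 1 2) (chartPlaqCost H y 1 2) -
        Tilt.tiltCov (((volume : Measure (LandauFree H → E3)).restrict D).withDensity fun a => ENNReal.ofReal (gaussWeight β H a))
          (tiltU β H) 0 (chartPlaqCost H x 1 2) (chartPlaqCost H y 1 2)| ≤ 96 * τ := by
  have h := GaussRestrict.abs_gaussCov_sub_tiltCov_muSet_zero_le hβ hD hτ hτ2 (tiltU β H) (EdgeChartGaussian.measurable_chartPlaqCost H x 1 2)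
    (EdgeChartGaussian.measurable_chartPlaqCost H y 1 2) (PlaqObsL2.abs_chartPlaqCost_le H x 1 2) (PlaqObsL2.abs_chartPlaqCost_le H y 1 2)
  calc _ ≤ 6 * τ * (4 : ℝ) ^ 2 := h
    _ = 96 * τ := by ring

/-- ★★ **13f₀′ — the `t = 0` end of the interpolation over `μ_{D′}`, GENERAL measurable `D′`.**  There is `C` (✓13m's) such that for all `H ≥ 1`, `β ≥ 1`,
all measurable `D′`, all `τ` with `E₀[1 − 1_{D′}] ≤ τ ≤ 1/2` and all `T`:
`|β²·Tilt.tiltCov μ_{D′} (tiltU β H) 0 c_{boxCentre} c_{boxCentre + T e₀} − (3/4)·boxDirCircSqCov H T| ≤ 96·τ·β² + C/β`. -/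
theorem abs_sq_mul_tiltCov_muSet_zero_sub_main_le : ∃ C : ℝ, ∀ H : ℕ, 1 ≤ H → ∀ β : ℝ, 1 ≤ β → ∀ D : Set (LandauFree H → E3), MeasurableSet D →
    ∀ τ : ℝ, gaussAvg β H (fun a => 1 - D.indicator (fun _ => (1 : ℝ)) a) ≤ τ → τ ≤ 1 / 2 → ∀ T : ℕ,
      |β ^ 2 * Tilt.tiltCov (((volume : Measure (LandauFree H → E3)).restrict D).withDensity fun a => ENNReal.ofReal (gaussWeight β H a))
            (tiltU β H) 0 (chartPlaqCost H (boxCentre H) 1 2) (chartPlaqCost H (boxCentre H + Pi.single 0 (T : ℤ)) 1 2) -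
          3 / 4 * boxDirCircSqCov H T| ≤ 96 * τ * β ^ 2 + C / β := by
  obtain ⟨C, hC⟩ := EdgeChartGaussian.gaussCov_chartPlaqCost_sub_linCurvSq_le
  refine ⟨C, fun H hH β hβ1 D hD τ hτ hτ2 T => ?_⟩
  have hβ : 0 < β := by linarith
  set x := boxCentre H
  set y := boxCentre H + Pi.single 0 (T : ℤ)
  set tc := Tilt.tiltCov (((volume : Measure (LandauFree H → E3)).restrict D).withDensity fun a => ENNReal.ofReal (gaussWeight β H a))
    (tiltU β H) 0 (chartPlaqCost H x 1 2) (chartPlaqCost H y 1 2)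
  set gc := gaussCov β H (chartPlaqCost H x 1 2) (chartPlaqCost H y 1 2)
  set gl := gaussCov β H (linCurvSq H (plaq12At x)) (linCurvSq H (plaq12At y))
  have h1 : |gc - tc| ≤ 96 * τ := abs_gaussCov_sub_tiltCov_muSet_zero_le_chartPlaqCost hβ hD hτ hτ2 x y
  have h2 : |gc - gl| ≤ C / β ^ 3 := hC H hH β hβ1 x y
  have h3 : β ^ 2 * gl = 3 / 4 * boxDirCircSqCov H T := mainTermWick H hH β hβ T
  have e : β ^ 2 * tc - 3 / 4 * boxDirCircSqCov H T = β ^ 2 * (tc - gc) + β ^ 2 * (gc - gl) := by rw [← h3]; ring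
  rw [e]
  have hβ2 : 0 ≤ β ^ 2 := sq_nonneg _
  calc |β ^ 2 * (tc - gc) + β ^ 2 * (gc - gl)| ≤ |β ^ 2 * (tc - gc)| + |β ^ 2 * (gc - gl)| := abs_add_le _ _
    _ = β ^ 2 * |tc - gc| + β ^ 2 * |gc - gl| := by rw [abs_mul, abs_mul, abs_of_nonneg hβ2]
    _ ≤ β ^ 2 * (96 * τ) + β ^ 2 * (C / β ^ 3) := by
        rw [abs_sub_comm] at h1
        exact add_le_add (mul_le_mul_of_nonneg_left h1 hβ2) (mul_le_mul_of_nonneg_left h2 hβ2)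
    _ = 96 * τ * β ^ 2 + C / β := by
        field_simp

end GaussNormalForm

/-! ## §3 The Gaussian-side co-mass `τ″` of the cut small field `smallField H s ∖ E` -/

namespace GaussRestrict

open EdgeChartGaussian (integrable_gaussWeight integral_gaussWeight_pos gaussWeight_pos)

variable {H : ℕ} {β : ℝ}

/-- `1 − 1_{D∖E} = (1 − 1_D) + 1_D·1_E` pointwise. -/
theorem one_sub_indicator_diff_eq (D E : Set (LandauFree H → E3)) (a : LandauFree H → E3) :
    1 - (D \ E).indicator (fun _ => (1 : ℝ)) a =
      (1 - D.indicator (fun _ => (1 : ℝ)) a) + D.indicator (fun _ => (1 : ℝ)) a * E.indicator (fun _ => (1 : ℝ)) a := by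
  by_cases hD : a ∈ D <;> by_cases hE : a ∈ E
  · simp [indicator_of_mem hD, indicator_of_mem hE, indicator_of_notMem (show a ∉ D \ E from fun h => h.2 hE)]
  · simp [indicator_of_mem hD, indicator_of_notMem hE, indicator_of_mem (show a ∈ D \ E from ⟨hD, hE⟩)]
  · simp [indicator_of_notMem hD, indicator_of_notMem (show a ∉ D \ E from fun h => hD h.1)]
  · simp [indicator_of_notMem hD, indicator_of_notMem (show a ∉ D \ E from fun h => hD h.1)]

/-- `1_D·1_E` is measurable, valued in `[0,1]`. -/
theorem indicator_mul_indicator_mem_Icc (D E : Set (LandauFree H → E3)) (a : LandauFree H → E3) :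
    0 ≤ D.indicator (fun _ => (1 : ℝ)) a * E.indicator (fun _ => (1 : ℝ)) a ∧ D.indicator (fun _ => (1 : ℝ)) a * E.indicator (fun _ => (1 : ℝ)) a ≤ 1 := by
  obtain ⟨h0, h1⟩ := indicator_one_nonneg_le_one D a
  obtain ⟨h0', h1'⟩ := indicator_one_nonneg_le_one E a
  exact ⟨mul_nonneg h0 h0', by nlinarith⟩

/-- ★ **`E₀[1 − 1_{D∖E}] = E₀[1 − 1_D] + E₀[1_D·1_E]`** for measurable `D`, `E` (`β > 0`). -/
theorem gaussAvg_one_sub_indicator_diff_eq (hβ : 0 < β) {D E : Set (LandauFree H → E3)} (hD : MeasurableSet D) (hE : MeasurableSet E) :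
    gaussAvg β H (fun a => 1 - (D \ E).indicator (fun _ => (1 : ℝ)) a) =
      gaussAvg β H (fun a => 1 - D.indicator (fun _ => (1 : ℝ)) a) +
        gaussAvg β H (fun a => D.indicator (fun _ => (1 : ℝ)) a * E.indicator (fun _ => (1 : ℝ)) a) := by
  have hI : Integrable fun a : LandauFree H → E3 => (1 - D.indicator (fun _ => (1 : ℝ)) a) * gaussWeight β H a :=
    Tilt.integrable_bdd_mul_gaussWeight H hβ (measurable_const.sub (measurable_const.indicator hD)) (C := 1) (abs_one_sub_indicator_le D)
  have hJ : Integrable fun a : LandauFree H → E3 => (D.indicator (fun _ => (1 : ℝ)) a * E.indicator (fun _ => (1 : ℝ)) a) * gaussWeight β H a :=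
    Tilt.integrable_bdd_mul_gaussWeight H hβ ((measurable_const.indicator hD).mul (measurable_const.indicator hE)) (C := 1) fun a => by
      obtain ⟨h0, h1⟩ := indicator_mul_indicator_mem_Icc D E a
      rw [abs_of_nonneg h0]; exact h1
  rw [← EdgeChartGaussian.gaussAvg_add β H hI hJ]
  congr 1
  funext a
  exact one_sub_indicator_diff_eq D E a

/-- ★ **The Gaussian mass of the cubic-cut event inside the small field, for EVERY shift constant `C₅ ≥ 0`.**  With `C` = ✓w5's constant of
`gaussAvg_sfInd_mul_indicator_cubicVertex_le`: for `H ≥ 1`, `β > 0`, `s ≥ 0` with `C·β·H⁴·s⁵ ≤ 1/2`, every `C₅ ≥ 0` and every moment order `r ≥ 1`,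
`E₀[1_{smallField s} · 1_{{1 + C₅βH⁴s⁵ ≤ |cubicVertex β H ·|}}] ≤ 4^r · (2r−1)^{3r} · (C·H⁴·(1+log H)³/β)^r`
(the event is contained in `{1/2 + CβH⁴s⁵ ≤ |V₃|}`, where ✓w5's bound at `λ = 1/2` applies). -/
theorem gaussAvg_sfInd_mul_indicator_cubicCut_le : ∃ C : ℝ, 0 ≤ C ∧ ∀ H : ℕ, 1 ≤ H → ∀ β : ℝ, 0 < β → ∀ s : ℝ, 0 ≤ s →
    C * β * (H : ℝ) ^ 4 * s ^ 5 ≤ 1 / 2 → ∀ C₅ : ℝ, 0 ≤ C₅ → ∀ r : ℕ, 1 ≤ r →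
      gaussAvg β H (fun a => sfInd H s a * Set.indicator {a | 1 + C₅ * β * (H : ℝ) ^ 4 * s ^ 5 ≤ |cubicVertex β H a|} (fun _ => (1 : ℝ)) a) ≤
        (4 : ℝ) ^ r * ((2 * r - 1 : ℝ) ^ (r * 3) * (C * (H : ℝ) ^ 4 * (1 + Real.log H) ^ 3 / β) ^ r) := by
  obtain ⟨C, hC, h5⟩ := EdgeChartGaussian.gaussAvg_sfInd_mul_indicator_cubicVertex_le
  refine ⟨C, hC, fun H hH β hβ s hs hshift C₅ hC₅ r hr => ?_⟩
  set E : Set (LandauFree H → E3) := {a | 1 + C₅ * β * (H : ℝ) ^ 4 * s ^ 5 ≤ |cubicVertex β H a|} with hEdef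
  set E' : Set (LandauFree H → E3) := {a | 1 / 2 + C * β * (H : ℝ) ^ 4 * s ^ 5 ≤ |cubicVertex β H a|} with hE'def
  have hEm : MeasurableSet E := SmallFieldFP.measurableSet_cubicCut β C₅ s 1
  have hE'm : MeasurableSet E' := SmallFieldFP.measurableSet_cubicCut β C s (1 / 2)
  have hsub : E ⊆ E' := fun a ha => by
    simp only [hEdef, hE'def, Set.mem_setOf_eq] at ha ⊢
    have : 0 ≤ C₅ * β * (H : ℝ) ^ 4 * s ^ 5 := by positivity
    linarith
  have hmono : ∀ a, sfInd H s a * E.indicator (fun _ => (1 : ℝ)) a ≤ sfInd H s a * E'.indicator (fun _ => (1 : ℝ)) a := fun a =>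
    mul_le_mul_of_nonneg_left (indicator_le_indicator_of_subset hsub (fun _ => zero_le_one) a) (TiltSup.sfInd_nonneg_le_one (H := H) s a).1
  have hint : ∀ {A : Set (LandauFree H → E3)}, MeasurableSet A →
      Integrable fun a : LandauFree H → E3 => (sfInd H s a * A.indicator (fun _ => (1 : ℝ)) a) * gaussWeight β H a := fun {A} hA =>
    Tilt.integrable_bdd_mul_gaussWeight H hβ ((Tilt.measurable_sfInd H s).mul (measurable_const.indicator hA)) (C := 1) fun a => by
      obtain ⟨h0, h1⟩ := indicator_mul_indicator_mem_Icc (smallField H s) A a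
      rw [sfInd_eq_indicator] at *
      rw [abs_of_nonneg h0]; exact h1
  have hm := EdgeChartGaussian.gaussAvg_mono H hβ hmono (hint hEm) (hint hE'm)
  have hw5 := h5 H hH β hβ s hs (1 / 2) (by norm_num) r hr
  have h14 : (1 / 2 : ℝ) ^ (2 * r) = 1 / (4 : ℝ) ^ r := by
    rw [pow_mul, ← one_div_pow]; norm_num
  have hid : (2 * r - 1 : ℝ) ^ (r * 3) * (C * (H : ℝ) ^ 4 * (1 + Real.log H) ^ 3 / β) ^ r / (1 / 2 : ℝ) ^ (2 * r) =
      (4 : ℝ) ^ r * ((2 * r - 1 : ℝ) ^ (r * 3) * (C * (H : ℝ) ^ 4 * (1 + Real.log H) ^ 3 / β) ^ r) := by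
    rw [h14, div_div_eq_mul_div, div_one]
    ring
  rw [hid] at hw5
  exact hm.trans hw5

/-- ★★ **The Gaussian-side co-mass `τ″` of the cut small field.**  There are `C₆`, `c > 0` (✓6g) and `C ≥ 0` (✓w5) such that for `H ≥ 1`, `β > 0`, `s > 0` with
`C·β·H⁴·s⁵ ≤ 1/2`, every `C₅ ≥ 0` and every `r ≥ 1`, with `E = {1 + C₅βH⁴s⁵ ≤ |cubicVertex β H ·|}`:
`E₀[1 − 1_{smallField H s ∖ E}] ≤ C₆·H⁴·e^{−cβs²} + 4^r·(2r−1)^{3r}·(C·H⁴(1+log H)³/β)^r`. -/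
theorem gaussAvg_one_sub_indicator_cutSet_le : ∃ C₆ c C : ℝ, 0 < c ∧ 0 ≤ C ∧ ∀ H : ℕ, 1 ≤ H → ∀ β s : ℝ, 0 < β → 0 < s →
    C * β * (H : ℝ) ^ 4 * s ^ 5 ≤ 1 / 2 → ∀ C₅ : ℝ, 0 ≤ C₅ → ∀ r : ℕ, 1 ≤ r →
      gaussAvg β H (fun a => 1 - (smallField H s \ {a | 1 + C₅ * β * (H : ℝ) ^ 4 * s ^ 5 ≤ |cubicVertex β H a|}).indicator (fun _ => (1 : ℝ)) a) ≤
        C₆ * (H : ℝ) ^ 4 * Real.exp (-(c * β * s ^ 2)) +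
          (4 : ℝ) ^ r * ((2 * r - 1 : ℝ) ^ (r * 3) * (C * (H : ℝ) ^ 4 * (1 + Real.log H) ^ 3 / β) ^ r) := by
  obtain ⟨C₆, c, hc, h6g⟩ := gaussianSmallFieldTail
  obtain ⟨C, hC, hcut⟩ := gaussAvg_sfInd_mul_indicator_cubicCut_le
  refine ⟨C₆, c, C, hc, hC, fun H hH β s hβ hs hshift C₅ hC₅ r hr => ?_⟩
  rw [gaussAvg_one_sub_indicator_diff_eq hβ (ChartGauss.measurableSet_smallField s) (SmallFieldFP.measurableSet_cubicCut β C₅ s 1)]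
  exact add_le_add (h6g H hH β s hβ hs) (hcut H hH β hβ s hs.le hshift C₅ hC₅ r hr)

end GaussRestrict

end Summit.QuantumFields.YangMills.Theorems.AllWindowsColdBoxBoxHighLine

end
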